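import Literature.Computability.Complexity.NPClosureProofs
import Literature.Computability.Complexity.SearchToDecision
import Literature.Computability.Complexity.BrickAlgebra
import HarnessLib

/-!
# The alternating-certificate semantics of `Σₖᵖ` and its downward self-reducible game

Trunk toolkit (`Literature/Computability/Complexity`), continuing `PolyHierarchy.lean`
(`Σₖᵖ = sigmaP P k`, iterated class operators `Σₖ₊₁ = ∃ᵖ·co Σₖ`) and `NPClosureProofs.lean`
(closure of `Σₖᵖ` under `FP`-preimages and `∩`/`∪` with `P`).

* `altVal B ps x` — the **alternating ("negamax") certificate semantics**: for a matrix language `B`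
  and a list of certificate-length polynomials `ps = [p₁, …, p_k]`,
  `altVal B [] x = [x ∈ B]` and `altVal B (p :: ps) x = ∃ y, |y| ≤ p(|x|) ∧ ¬ altVal B ps ⟨x, y⟩`.
  This is literally the iterated definition of the hierarchy: `altLang B ps ∈ sigmaP P |ps|` for
  `B ∈ P` (`altLang_mem_sigmaP`, by `rfl`-unfolding `Σₖ₊₁ = ∃ᵖ·co Σₖ`), and conversely EVERY
  `L ∈ Σₖᵖ` has such a presentation (`exists_altVal_of_mem_SigmaP`) — the prenex form
  `x ∈ L ↔ ∃ y₁ ¬ ∃ y₂ ¬ ⋯ [⟨⟨x, y₁⟩, …, y_k⟩ ∈ B]` of Stockmeyer 1976, Thm. 3.1 / Wrathall 1976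
  (with variable-length certificates `|yᵢ| ≤ pᵢ(|xᵢ₋₁|)`, exactly as in the tree's `polyExists`).
* `posVal B ps i x' u` — the value of a **position** of the evaluation game of this presentation:
  level `i` (certificates `y₁ … yᵢ` already absorbed into `x' = ⟨⟨x, y₁⟩, …, yᵢ⟩`) and a partial
  certificate `u` of level `i + 1`, grown at the FRONT (suffix search, as in `SearchToDecision.lean`):
  "some `y = v ++ u` with `|y| ≤ p_{i+1}(|x'|)` refutes the opponent", and at the last level `[x' ∈ B]`.
  **Downward self-reducibility** (`posVal_iff_queries`): the value of `(i, x', u)` is recomputed in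
  polynomial time from the values of the three positions `(i+1, ⟨x', u⟩, ε)`, `(i, x', 0u)`,
  `(i, x', 1u)`; the root `(0, x, ε)` has value `[x ∈ L]` (`posVal_zero_nil`). This is the abstract
  form of "`Σₖ SAT` is downward self-reducible" used by Chen–Jin–Santhanam–Williams 2022, §5.2
  (proof of Thm. 5 / Cor. 4) — here for an ARBITRARY `Σₖᵖ` language through its presentation, so
  that no `Σₖ`-complete formula language is needed.
* `posLang B ps i ∈ SigmaP k` for `|ps| = k` (`posLang_mem_SigmaP`): the language of true positions of
  level `i` is `∃ᵖ·Π` of the right level (witness map `suffMap` of `SearchToDecision.lean`).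

Everything is proved; no named facts.

## References

* L. J. Stockmeyer, *The polynomial-time hierarchy*, TCS 3 (1976), §3, Thm. 3.1 (quantifier
  characterisation of `Σₖᵖ`). [Stockmeyer1976]
* S. Arora, B. Barak, *Computational Complexity: A Modern Approach*, CUP 2009, Def. 5.3, Thm. 5.4
  (`Σᵢ SAT`), §2.5 (downward self-reducibility / search-to-decision). [AroraBarakCC2009]
* L. Chen, C. Jin, R. Santhanam, R. Williams, *Constructive separations and their consequences*,
  FOCS 2021, §5.2 (Thm. 5: "Σₖ P has a downward self-reducible complete language Σₖ SAT").
  [ChenEtAl2022]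
-/

namespace Literature.Computability.Complexity

open _root_.Computability Polynomial Brick

/-! ### The alternating semantics -/

/-- **Alternating certificate semantics.** `altVal B [] x = [x ∈ B]`,
`altVal B (p :: ps) x = ∃ y, |y| ≤ p(|x|) ∧ ¬ altVal B ps ⟨x, y⟩` (the existential player moves and
hands the negated game to the opponent). [cite: Stockmeyer1976, §3 Thm. 3.1] -/
def altVal (B : Language Bool) : List (Polynomial ℕ) → List Bool → Prop
  | [], x => x ∈ B
  | p :: ps, x => ∃ y : List Bool, y.length ≤ p.eval x.length ∧ ¬ altVal B ps (boolPair x y)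

/-- The language `{x | altVal B ps x}`. [cite: Stockmeyer1976, §3 Thm. 3.1] -/
def altLang (B : Language Bool) (ps : List (Polynomial ℕ)) : Language Bool :=
  {x | altVal B ps x}

/-- Membership in `altLang`. [folklore] -/
@[simp] theorem mem_altLang (B : Language Bool) (ps : List (Polynomial ℕ)) (x : List Bool) :
    x ∈ altLang B ps ↔ altVal B ps x :=
  Iff.rfl

/-- `altVal B [] x ↔ x ∈ B`. [folklore] -/
@[simp] theorem altVal_nil (B : Language Bool) (x : List Bool) : altVal B [] x ↔ x ∈ B :=
  Iff.rfl

/-- `altVal B (p :: ps) x ↔ ∃ y, |y| ≤ p(|x|) ∧ ¬ altVal B ps ⟨x, y⟩`. [folklore] -/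
theorem altVal_cons (B : Language Bool) (p : Polynomial ℕ) (ps : List (Polynomial ℕ)) (x : List Bool) :
    altVal B (p :: ps) x ↔ ∃ y : List Bool, y.length ≤ p.eval x.length ∧ ¬ altVal B ps (boolPair x y) :=
  Iff.rfl

/-- **`altLang B ps ∈ Σ_{|ps|}ᵖ` for `B ∈ P`** — definitionally the iterated operator
`Σₖ₊₁ = ∃ᵖ·co Σₖ` (`sigmaP_succ`), the matrix of the existential block being the complement of the
previous level's language. [cite: AroraBarakCC2009, Def. 5.3 and Remark 5.8] -/
theorem altLang_mem_sigmaP {B : Language Bool} (hB : B ∈ Classes.P) :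
    ∀ ps : List (Polynomial ℕ), altLang B ps ∈ sigmaP Classes.P ps.length
  | [] => by
    have h : altLang B [] = B := by ext x; rfl
    rw [h]; exact hB
  | p :: ps => by
    change altLang B (p :: ps) ∈ polyExists (co (sigmaP Classes.P ps.length))
    refine ⟨(altLang B ps)ᶜ, ?_, p, fun x => ?_⟩
    · change (altLang B ps)ᶜᶜ ∈ sigmaP Classes.P ps.length
      rw [compl_compl]
      exact altLang_mem_sigmaP hB ps
    · rfl

/-- `altLang B ps ∈ SigmaP |ps|` (the unrelativised hierarchy). [cite: AroraBarakCC2009, Def. 5.3] -/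
theorem altLang_mem_SigmaP {B : Language Bool} (hB : B ∈ Classes.P) (ps : List (Polynomial ℕ)) :
    altLang B ps ∈ SigmaP ps.length :=
  altLang_mem_sigmaP hB ps

/-- **Every `Σₖᵖ` language has an alternating presentation**: for `L ∈ Σₖᵖ` there are a matrix
`B ∈ P` and certificate-length polynomials `ps`, `|ps| = k`, with `x ∈ L ↔ altVal B ps x` for all `x`
(unfold `Σₖ = ∃ᵖ·co Σₖ₋₁` `k` times; the complement of a level is presented by negating its game).
[cite: Stockmeyer1976, §3 Thm. 3.1] -/
theorem exists_altVal_of_mem_SigmaP :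
    ∀ (k : ℕ) {L : Language Bool}, L ∈ SigmaP k →
      ∃ B ∈ Classes.P, ∃ ps : List (Polynomial ℕ), ps.length = k ∧ ∀ x : List Bool, x ∈ L ↔ altVal B ps x
  | 0, L, hL => ⟨L, hL, [], rfl, fun _ => Iff.rfl⟩
  | k + 1, L, hL => by
    obtain ⟨N, hN, p, hp⟩ := hL
    -- `N ∈ co Σₖ`, i.e. `Nᶜ ∈ Σₖ`: present the complement
    obtain ⟨B, hB, ps, hlen, hiff⟩ := exists_altVal_of_mem_SigmaP k (L := Nᶜ) hN
    refine ⟨B, hB, p :: ps, by simp [hlen], fun x => ?_⟩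
    rw [hp x, altVal_cons]
    refine exists_congr fun y => and_congr_right fun _ => ?_
    rw [← hiff]
    exact not_not.symm

/-! ### Positions of the evaluation game and downward self-reducibility -/

/-- The value of a position, by the remaining certificate polynomials: at the matrix `[x' ∈ B]`;
with `p :: ps'` remaining, "some certificate `v ++ u` extending the partial certificate `u` at the
front, of length `≤ p(|x'|)`, refutes the opponent's game `ps'` on `⟨x', v ++ u⟩`".
[cite: ChenEtAl2022, §5.2 (proof of Thm. 5)] -/
def posValAux (B : Language Bool) : List (Polynomial ℕ) → List Bool → List Bool → Prop
  | [], x', _ => x' ∈ B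
  | p :: ps', x', u => ∃ v : List Bool, (v ++ u).length ≤ p.eval x'.length ∧
      ¬ altVal B ps' (boolPair x' (v ++ u))

/-- **The value of the position `(i, x', u)`** of the game of the presentation `(B, ps)`: level `i`
(so `ps.drop i` polynomials remain), accumulated instance `x'`, partial certificate `u`.
[cite: ChenEtAl2022, §5.2 (proof of Thm. 5)] -/
def posVal (B : Language Bool) (ps : List (Polynomial ℕ)) (i : ℕ) (x' u : List Bool) : Prop :=
  posValAux B (ps.drop i) x' u

/-- At or beyond the last level the value is the matrix bit `[x' ∈ B]`. [folklore] -/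
theorem posVal_of_drop_eq_nil {B : Language Bool} {ps : List (Polynomial ℕ)} {i : ℕ}
    (h : ps.drop i = []) (x' u : List Bool) : posVal B ps i x' u ↔ x' ∈ B := by
  unfold posVal; rw [h]; rfl

/-- Inside the hierarchy (`ps.drop i = p :: ps'`) the value is the existential statement over
extensions of `u`. [folklore] -/
theorem posVal_of_drop_eq_cons {B : Language Bool} {ps : List (Polynomial ℕ)} {i : ℕ}
    {p : Polynomial ℕ} {ps' : List (Polynomial ℕ)} (h : ps.drop i = p :: ps') (x' u : List Bool) :
    posVal B ps i x' u ↔ ∃ v : List Bool, (v ++ u).length ≤ p.eval x'.length ∧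
      ¬ altVal B ps' (boolPair x' (v ++ u)) := by
  unfold posVal; rw [h]; rfl

/-- **A fresh position (`u = ε`) has the value of the remaining game**:
`posVal B ps i x' [] ↔ altVal B (ps.drop i) x'`. [folklore] -/
theorem posVal_nil_right (B : Language Bool) (ps : List (Polynomial ℕ)) (i : ℕ) (x' : List Bool) :
    posVal B ps i x' [] ↔ altVal B (ps.drop i) x' := by
  unfold posVal
  cases ps.drop i with
  | nil => rfl
  | cons p ps' =>
    simp only [posValAux, List.append_nil, altVal_cons]

/-- **The root position has the value of the whole game**: `posVal B ps 0 x [] ↔ altVal B ps x`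
(so `↔ x ∈ L` for a presentation of `L`). [cite: ChenEtAl2022, §5.2 (proof of Thm. 5)] -/
theorem posVal_zero_nil (B : Language Bool) (ps : List (Polynomial ℕ)) (x : List Bool) :
    posVal B ps 0 x [] ↔ altVal B ps x := by
  rw [posVal_nil_right, List.drop_zero]

/-- `ps.drop (i+1)` is the tail of `ps.drop i`. [folklore] -/
theorem drop_succ_eq_of_drop_eq_cons {α : Type} {ps : List α} {i : ℕ} {p : α} {ps' : List α}
    (h : ps.drop i = p :: ps') : ps.drop (i + 1) = ps' := by
  rw [← List.drop_drop, h]; rfl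

/-- **Downward self-reducibility of the game.** Inside the hierarchy (`ps.drop i = p :: ps'`,
`P = p(|x'|)`), the value of `(i, x', u)` is recomputed from the values of the three positions
`(i+1, ⟨x', u⟩, ε)` (is `u` itself a refuting certificate? — a NEGATED query one level down),
`(i, x', 0u)` and `(i, x', 1u)` (does a longer extension refute?):
`posVal i x' u ↔ (|u| ≤ P ∧ ¬ posVal (i+1) ⟨x', u⟩ ε) ∨ (|u| < P ∧ (posVal i x' 0u ∨ posVal i x' 1u))`.
[cite: ChenEtAl2022, §5.2 (proof of Thm. 5: "M(x) = D^{M_{≤ m-1}}(x)")] -/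
theorem posVal_iff_queries {B : Language Bool} {ps : List (Polynomial ℕ)} {i : ℕ}
    {p : Polynomial ℕ} {ps' : List (Polynomial ℕ)} (h : ps.drop i = p :: ps') (x' u : List Bool) :
    posVal B ps i x' u ↔
      (u.length ≤ p.eval x'.length ∧ ¬ posVal B ps (i + 1) (boolPair x' u) []) ∨
      (u.length < p.eval x'.length ∧
        (posVal B ps i x' (false :: u) ∨ posVal B ps i x' (true :: u))) := by
  have hbase : posVal B ps (i + 1) (boolPair x' u) [] ↔ altVal B ps' (boolPair x' u) := by
    rw [posVal_nil_right, drop_succ_eq_of_drop_eq_cons h]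
  rw [hbase, posVal_of_drop_eq_cons h, posVal_of_drop_eq_cons h, posVal_of_drop_eq_cons h]
  constructor
  · rintro ⟨v, hv, hval⟩
    rcases List.eq_nil_or_concat' v with rfl | ⟨v', b, rfl⟩
    · exact Or.inl ⟨by simpa using hv, by simpa using hval⟩
    · have e : v' ++ [b] ++ u = v' ++ (b :: u) := by simp
      rw [e] at hv hval
      have hlt : u.length < p.eval x'.length := by
        have : (v' ++ (b :: u)).length = v'.length + u.length + 1 := by simp; omega
        omega
      refine Or.inr ⟨hlt, ?_⟩
      cases b
      · exact Or.inl ⟨v', hv, hval⟩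
      · exact Or.inr ⟨v', hv, hval⟩
  · rintro (⟨hu, hval⟩ | ⟨-, ⟨v', hv, hval⟩ | ⟨v', hv, hval⟩⟩)
    · exact ⟨[], by simpa using hu, by simpa using hval⟩
    · exact ⟨v' ++ [false], by simpa using hv, by simpa using hval⟩
    · exact ⟨v' ++ [true], by simpa using hv, by simpa using hval⟩

/-- Inside the hierarchy, a position whose partial certificate is already too long is false.
[folklore] -/
theorem not_posVal_of_length_gt {B : Language Bool} {ps : List (Polynomial ℕ)} {i : ℕ}
    {p : Polynomial ℕ} {ps' : List (Polynomial ℕ)} (h : ps.drop i = p :: ps') {x' u : List Bool}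
    (hu : p.eval x'.length < u.length) : ¬ posVal B ps i x' u := by
  rw [posVal_of_drop_eq_cons h]
  rintro ⟨v, hv, -⟩
  have : u.length ≤ (v ++ u).length := by simp
  omega

/-! ### The languages of true positions are in `Σₖᵖ` -/

/-- `Σₐᵖ ⊆ Σ_bᵖ` for `a ≤ b` (iterate `SigmaP_subset_succ`). [cite: AroraBarakCC2009, Def. 5.3] -/
theorem SigmaP_mono_le {a b : ℕ} (h : a ≤ b) : SigmaP a ⊆ SigmaP b := by
  induction h with
  | refl => exact le_rfl
  | step _ ih => exact ih.trans (SigmaP_subset_succ_holds _)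

/-- **The language of true positions of level `i`**: `⟨x', u⟩ ∈ posLang B ps i ↔ posVal B ps i x' u`
(components read off with the total decoder, so the language is defined on every string).
[cite: ChenEtAl2022, §5.2 (proof of Thm. 5)] -/
def posLang (B : Language Bool) (ps : List (Polynomial ℕ)) (i : ℕ) : Language Bool :=
  {w | posVal B ps i (fstF w) (sndF w)}

/-- Membership of a pair in `posLang`. [folklore] -/
@[simp] theorem boolPair_mem_posLang (B : Language Bool) (ps : List (Polynomial ℕ)) (i : ℕ)
    (x' u : List Bool) : boolPair x' u ∈ posLang B ps i ↔ posVal B ps i x' u := by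
  change posVal B ps i (fstF (boolPair x' u)) (sndF (boolPair x' u)) ↔ _
  rw [fstF_boolPair, sndF_boolPair]

/-- Membership of an arbitrary string in `posLang`. [folklore] -/
theorem mem_posLang_iff (B : Language Bool) (ps : List (Polynomial ℕ)) (i : ℕ) (w : List Bool) :
    w ∈ posLang B ps i ↔ posVal B ps i (fstF w) (sndF w) :=
  Iff.rfl

/-- **`posLang B ps i ∈ Σₖᵖ`** for `B ∈ P` and `|ps| = k`: at the matrix level it is `fstF⁻¹ B ∈ P`;
inside the hierarchy (`ps.drop i = p :: ps'`) it is `∃ᵖ` (witness `v`, bound `p`) of the `Π_{|ps'|}`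
matrix `suffMap⁻¹ (LenLe p ∩ (altLang B ps')ᶜ)` (`suffMap ⟨⟨x', u⟩, v⟩ = ⟨x', v ++ u⟩`), hence in
`Σ_{|ps'|+1} ⊆ Σₖ`. [cite: AroraBarakCC2009, Def. 5.3; Stockmeyer1976 §3] -/
theorem posLang_mem_SigmaP {B : Language Bool} (hB : B ∈ Classes.P) (ps : List (Polynomial ℕ))
    (i : ℕ) : posLang B ps i ∈ SigmaP ps.length := by
  rcases hd : ps.drop i with _ | ⟨p, ps'⟩
  · -- matrix level
    have he : posLang B ps i = fstF ⁻¹' B := by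
      ext w
      rw [mem_posLang_iff, posVal_of_drop_eq_nil hd]
      rfl
    rw [he]
    exact P_subset_SigmaP _ (preimage_mem_P hB fstF_mem_FP)
  · -- inside the hierarchy: level `|ps'| + 1 ≤ |ps|`
    have hlen : ps'.length + 1 ≤ ps.length := by
      have := congrArg List.length hd
      simp only [List.length_drop, List.length_cons] at this
      omega
    refine SigmaP_mono_le hlen ?_
    change posLang B ps i ∈ polyExists (co (SigmaP ps'.length))
    -- the matrix
    obtain ⟨hcl, hin, hun⟩ := SigmaP_closure ps'.length
    set M : Language Bool := suffMap ⁻¹' (LenLe p ⊓ (altLang B ps')ᶜ) with hM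
    have hMco : M ∈ co (SigmaP ps'.length) := by
      refine preimage_mem_co hcl (inter_P_mem_co hun (LenLe_mem_P p) ?_) suffMap_mem_FP
      change (altLang B ps')ᶜᶜ ∈ SigmaP ps'.length
      rw [compl_compl]
      exact altLang_mem_SigmaP hB ps'
    have hmemM : ∀ w v : List Bool, boolPair w v ∈ M ↔
        (v ++ sndF w).length ≤ p.eval (fstF w).length ∧ ¬ altVal B ps' (boolPair (fstF w) (v ++ sndF w)) := by
      intro w v
      change suffMap (boolPair w v) ∈ LenLe p ∧ suffMap (boolPair w v) ∈ (altLang B ps')ᶜ ↔ _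
      rw [suffMap_apply, boolUnpair_boolPair, boolPair_mem_LenLe]
      rfl
    refine ⟨M, hMco, p, fun w => ?_⟩
    rw [mem_posLang_iff, posVal_of_drop_eq_cons hd]
    constructor
    · rintro ⟨v, hv, hval⟩
      refine ⟨v, ?_, (hmemM w v).2 ⟨hv, hval⟩⟩
      calc v.length ≤ (v ++ sndF w).length := by simp
        _ ≤ p.eval (fstF w).length := hv
        _ ≤ p.eval w.length := TM2Iter.eval_mono p (by have := length_fstF_sndF_le w; omega)
    · rintro ⟨v, -, hv⟩
      exact ⟨v, ((hmemM w v).1 hv).1, ((hmemM w v).1 hv).2⟩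

/-- **The root map is a reduction of `L` to the position language of level `0`**: for a presentation
`x ∈ L ↔ altVal B ps x`, `x ∈ L ↔ ⟨x, ε⟩ ∈ posLang B ps 0`. [cite: ChenEtAl2022, §5.2 (proof of Thm. 5)] -/
theorem mem_iff_boolPair_nil_mem_posLang {L B : Language Bool} {ps : List (Polynomial ℕ)}
    (hL : ∀ x : List Bool, x ∈ L ↔ altVal B ps x) (x : List Bool) :
    x ∈ L ↔ boolPair x [] ∈ posLang B ps 0 := by
  rw [boolPair_mem_posLang, posVal_zero_nil, hL]

end Literature.Computability.Complexity
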